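import Summits.BirchSwinnertonDyer.Rank1Residual.GaloisImage.KolyvaginDerivativeTate
import Summits.BirchSwinnertonDyer.Rank1Residual.GaloisImage.KolyvaginDerivativeLocalImageRat
import HarnessLib

/-!
# Kolyvagin's derivative classes of `T_p E` over `ℚ`: THEOREM A3 together with the local image
# condition at the bad places of prime-to-`p` degree (the `E/ℚ` reading of row T-DER-BN, file 5)
# (cell `b2b-bsdres`, team n1011, seat p15 GEN 6; skeleton `cells/n1011/skel/T-DER-BN.md` STATUS v6)

HONEST FRAMING (cell `b2b-bsdres`, run/shared/lean/b2b/bsd-rank1-residual/, verbatim in every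
file): the goal of the cell is to DELETE the COMBINATION-SHAPED residual classes of the
Birch–Swinnerton-Dyer formula for ALL analytic-rank `≤ 1` elliptic curves over `ℚ` — "full BSD
formula for every rank `≤ 1` curve in class `C`" assembled STRICTLY from published theorems — so
that the rank-`≤ 1` remainder becomes exactly the CONSTRUCTION-SHAPED classes, which are TYPED
(missing-input `Prop`s), NOT attempted. This is not "finishing BSD". Team n1011 (N10 / N11, the
additive block X4 ∧ `p = 3`): research route on the CONSTRUCTION-SHAPED class X4; no claim beyond the
stated classes; nothing is booked. One TOOL theorem (no definition, no named fact, no `sorry`).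

## What

`Rat.exists_sigma_kappa_localImage_tate`: in the EXACT hypothesis set of F5
(`Rat.exists_sigma_existsUnique_res_eq_deriv_tate`: an Euler system `c` for `T_p E` over the
cyclotomic levels `cyclotomicLevelsRat p S`, a `ℤ_p`-linear coefficient map `red : T_p E ⟶ T′` with
`p^k T′ = 0`, a level `r` of Kolyvagin primes of level `k ≥ 1`, `(T′)^{Gal(ℚ̄/ℚ(μ_r))} = 0`), the
generators `σ_ℓ`, a commutation proof and THE derivative class `κ_r ∈ H¹(ℚ, T′)`
(`res_{ℚ(μ_r)} κ_r = D_r (red_* c_{0,r})`, unique) exist AND, at every finite place `w ∉ r` whose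
degree in `ℚ(μ_r)` is prime to `p` (`¬ p ∣ ord(ℓ_w mod ∏_{ℓ ∈ r} ℓ)`; `w = p` and the bad places of
`E` allowed), the localisation `res_w^* κ_r ∈ H¹(ℚ_w, T′)` is `red_*` of a class of `H¹(ℚ_w, T_p E)`
— the local condition `𝓕_can,w = 𝓛_w` of the Kolyvagin-system files at the bad places `w ∣ N`,
`w ∤ rp` ([Rubin00] Thm. 4.5.1 / [MR04] Thm. 3.2.4).  F5 + file 4
(`Rat.exists_map_red_eq_localization_of_not_dvd_orderOf`); no new argument.  The good places
`v ∤ rpN` are F8 (`Rat.apply_eq_zero_of_resSubgroup_eq_deriv_cyclotomicLevelsRat`), the place `p`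
under `E(ℚ_p)[p] = 0` is F11/F12, and the cyclotomic-layer form is file 4b.

References: K. Rubin, *Euler Systems* (2000), Def. 4.4.4, Thm. 4.5.1; B. Mazur, K. Rubin, Mem. AMS
799 (2004), Thm. 3.2.4, App. A.
-/

noncomputable section

open CategoryTheory Function Finset Polynomial Field IsDedekindDomain
open scoped NumberField Classical
open Literature.NumberTheory.GaloisRepresentations Literature.NumberTheory.EllipticCurves

namespace Summit.BirchSwinnertonDyer.Rank1Residual.GaloisImage

namespace Derivative

namespace Rat

open _root_.Rat.HeightOneSpectrum

variable (W : WeierstrassCurve ℚ) [W.IsElliptic] [W.IsGloballyMinimal] (p : ℕ) [Fact p.Prime]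

/-- **Kolyvagin's derivative class of `T_p E` and its local image at the places of prime-to-`p`
degree** (F5 + file 4 of row T-DER-BN, hypotheses = F5's VERBATIM): there are generators `σ_ℓ`
(fixing `μ_m` for `ℓ ∤ m`, representing `Gal(ℚ(μ_ℓ)/ℚ)`), a commutation proof, and a class
`κ ∈ H¹(ℚ, T′)` such that (i) `res_{ℚ(μ_r)} κ = D_r (red_* c_{0,r})`, (ii) `κ` is the unique such
class, and (iii) for every finite `w ∉ r` with `¬ p ∣ ord(ℓ_w mod ∏_{ℓ∈r} ℓ)` there is
`z′ ∈ H¹(ℚ_w, T_p E)` with `red_* z′ = res_w^* κ`.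
[cite: Rubin2000, Def. 4.4.4 and Thm. 4.5.1] [cite: MazurRubin2004, Thm. 3.2.4 and App. A] -/
theorem exists_sigma_kappa_localImage_tate
    [Module.Free ℤ_[p] (W.tateModule p)] [Module.Finite ℤ_[p] (W.tateModule p)]
    [ContinuousSMul ℤ_[p] (W.tateModule p)]
    (S : Set (HeightOneSpectrum (𝓞 ℚ))) {k : ℕ} (hk : 0 < k)
    {c : ∀ (i : ℕ) (r : (cyclotomicLevelsRat p S).Ideals),
      H1 (W.tateGaloisRep p (W.continuous_galoisRepTate_holds p)) ((cyclotomicLevelsRat p S).level i r.1)}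
    (hc : IsEulerSystem (cyclotomicLevelsRat p S)
      (W.tateGaloisRep p (W.continuous_galoisRepTate_holds p)) p c)
    {M' : Type} [AddCommGroup M'] [Module ℤ_[p] M'] [TopologicalSpace M'] [IsTopologicalAddGroup M']
    [ContinuousSMul ℤ_[p] M'] {T' : GaloisRep ℚ ℤ_[p] M'}
    (red : (W.tateGaloisRep p (W.continuous_galoisRepTate_holds p)).toTopRep ⟶ T'.toTopRep)
    (hM : ∀ m : M', ((p : ℤ_[p]) ^ k) • m = 0)
    (r : (cyclotomicLevelsRat p S).Ideals)
    (hr : ∀ ℓ ∈ r.1, Kato.IsKolyvaginPrime W p k ((primesEquiv ℓ : Nat.Primes) : ℕ))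
    (h0 : ∀ v : T'.toTopRep, (∀ u : (cyclotomicLevelsRat p S).level ⊥ r.1,
      T'.toTopRep.ρ (u : absoluteGaloisGroup ℚ) v = v) → v = 0) :
    ∃ σ : HeightOneSpectrum (𝓞 ℚ) → absoluteGaloisGroup ℚ,
      (∀ ℓ ∈ r.1, ∀ m : ℕ, (((primesEquiv ℓ : Nat.Primes) : ℕ)).Coprime m → σ ℓ ∈ rootsOfUnityFixer ℚ m) ∧
      (∀ ℓ ∈ r.1, ∀ g : absoluteGaloisGroup ℚ,
        ∃ j < ((primesEquiv ℓ : Nat.Primes) : ℕ) - 1, (σ ℓ ^ j)⁻¹ * g ∈ (cyclotomicLevelsRat p S).tameLevel ℓ) ∧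
      ∃ comm, ∃ κ : continuousCohomology 1 T'.toTopRep,
        resSubgroup T'.toTopRep ((cyclotomicLevelsRat p S).level ⊥ r.1) 1 κ =
          (r.1.noncommProd (fun ℓ => ∑ j ∈ range (((primesEquiv ℓ : Nat.Primes) : ℕ) - 1),
              (j : Module.End ℤ_[p] (continuousCohomology 1
              (subgroupRep T'.toTopRep ((cyclotomicLevelsRat p S).level ⊥ r.1)))) *
            (conjMap T'.toTopRep ((cyclotomicLevelsRat p S).level ⊥ r.1) (σ ℓ) 1).hom.toLinearMap ^ j)
            comm)
          (ContinuousCohomology.map (ContinuousMonoidHom.id _)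
            (X := subgroupRep (W.tateGaloisRep p (W.continuous_galoisRepTate_holds p)).toTopRep
              ((cyclotomicLevelsRat p S).level ⊥ r.1))
            (Y := subgroupRep T'.toTopRep ((cyclotomicLevelsRat p S).level ⊥ r.1))
            ((TopRep.resFunctor ((cyclotomicLevelsRat p S).level ⊥ r.1).subtype).map red) 1
            (c ⊥ r)) ∧
        (∀ κ' : continuousCohomology 1 T'.toTopRep,
          resSubgroup T'.toTopRep ((cyclotomicLevelsRat p S).level ⊥ r.1) 1 κ' =
            (r.1.noncommProd (fun ℓ => ∑ j ∈ range (((primesEquiv ℓ : Nat.Primes) : ℕ) - 1),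
                (j : Module.End ℤ_[p] (continuousCohomology 1
                (subgroupRep T'.toTopRep ((cyclotomicLevelsRat p S).level ⊥ r.1)))) *
              (conjMap T'.toTopRep ((cyclotomicLevelsRat p S).level ⊥ r.1) (σ ℓ) 1).hom.toLinearMap ^ j)
              comm)
            (ContinuousCohomology.map (ContinuousMonoidHom.id _)
              (X := subgroupRep (W.tateGaloisRep p (W.continuous_galoisRepTate_holds p)).toTopRep
                ((cyclotomicLevelsRat p S).level ⊥ r.1))
              (Y := subgroupRep T'.toTopRep ((cyclotomicLevelsRat p S).level ⊥ r.1))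
              ((TopRep.resFunctor ((cyclotomicLevelsRat p S).level ⊥ r.1).subtype).map red) 1
              (c ⊥ r)) → κ' = κ) ∧
        ∀ (w : HeightOneSpectrum (𝓞 ℚ)), (∀ q ∈ r.1, q ≠ w) →
          ¬ p ∣ orderOf ((((primesEquiv w : Nat.Primes) : ℕ) :
            ZMod (∏ q ∈ r.1, ((primesEquiv q : Nat.Primes) : ℕ)))) →
          ∃ z' : continuousCohomology 1
              (TopRep.res (absGaloisRestrict ℚ (w.adicCompletion ℚ)).toMonoidHom
                (W.tateGaloisRep p (W.continuous_galoisRepTate_holds p)).toTopRep),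
            ContinuousCohomology.map (ContinuousMonoidHom.id (absoluteGaloisGroup (w.adicCompletion ℚ)))
              (X := TopRep.res (absGaloisRestrict ℚ (w.adicCompletion ℚ)).toMonoidHom
                (W.tateGaloisRep p (W.continuous_galoisRepTate_holds p)).toTopRep)
              (Y := TopRep.res (absGaloisRestrict ℚ (w.adicCompletion ℚ)).toMonoidHom T'.toTopRep)
              ((TopRep.resFunctor (absGaloisRestrict ℚ (w.adicCompletion ℚ)).toMonoidHom).map red) 1 z' =
            ContinuousCohomology.map (absGaloisRestrict ℚ (w.adicCompletion ℚ))
              (𝟙 (TopRep.res (absGaloisRestrict ℚ (w.adicCompletion ℚ)).toMonoidHom T'.toTopRep)) 1 κ := by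
  obtain ⟨σ, hcop, hcov, comm, κ, hκ, huniq⟩ :=
    exists_sigma_existsUnique_res_eq_deriv_tate W p S hk hc red hM r hr h0
  refine ⟨σ, hcop, hcov, comm, κ, hκ, fun κ' hκ' => huniq κ' hκ', fun w hw hord => ?_⟩
  exact Derivative.Rat.exists_map_red_eq_localization_of_not_dvd_orderOf red r σ _ comm κ hκ w hw hord

end Rat

end Derivative

end Summit.BirchSwinnertonDyer.Rank1Residual.GaloisImage

end
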